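import Summits.ResolutionOfSingularities.ResolutionOfSingularities.Theorems.FrobeniusClosingPatchingRelPerfectDepthPhaseCCarrierCountdown
import Summits.ResolutionOfSingularities.ResolutionOfSingularities.Theorems.FrobeniusClosingPatchingRelPerfectCentreSeqExtendOpen
import Literature.AlgebraicGeometry.Resolution.RegularCentreBlowupSeqIntegral
import Literature.AlgebraicGeometry.Resolution.ArithmeticalThreefoldsBlowupFormDimThree
import HarnessLib

/-!
# Crux `PatchingRelPerfect` (stmt-ResolutionOfSingularities-16161), chain W5.2 — F7(β) d = 2 (β-AX), X3 C-I finish: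
# THE LOCAL END GLUE — a principalisation of the residual produced on an OPEN containing its cosupport gives the `PhaseCOne`
# conclusion (consumer-side localisation, RULING G11-51 (5))

[OURS · L1 W5.2 · res-L1-w52-lead-1 g6 (RULING G11-51 (2)/(5): END GLUE = lead-1; «the U-shrink … + `…CentreSeqExtendOpen` `liftOpen`
+ "off X₀ the transform is ⊤" is the CONSUMER's»)] Replaces the role of NO printed item; NOT a statement of the manuscript under review;
fact-free.

CE1 (`…DepthPhaseCCarrierGameLift`, res-D-pv-046) and CE2 (…DepthPhaseCCarrierCountdown) are stated for a GLOBAL carrier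
`G ≤ K♭` snc with the members everywhere.  At a frozen stratum the carrier is an older member and `G ≤ K♭` holds only on an open
`X₀ ⊇ cosupp K♭` (the summands not through the stratum are units there but not globally); at a pole the member family is snc with the
bare host only near the pole.  So the carrier game is played on the OPEN SUBSCHEME `X₀` (regular, Noetherian) and its output — a multiple
blow-up `t₀` of `X₀` with regular centres over `cosupp K♭` making `K♭|_{X₀}𝒪` locally principal — is extended to `X`
(`CentreSeqExtend.exists_centreSeq_of_open`, tree) and fed to the END GLUE (`phaseCOne_conclusion_of_isEffectiveCartier`):
* `centreSeq_isIntegral_top_and_comap_ne_bot` — over an INTEGRAL scheme, a multiple blow-up with centres over the cosupport of a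
  non-zero ideal sheaf has integral top and non-zero transform (`IsBlowup.isIntegral`, `IsBlowup.comap_ne_bot` stage by stage) — so
  that «locally principal» upgrades to «effective Cartier» (`IsLocallyPrincipal.isEffectiveCartier_of_ne_bot`).
* `phaseCOne_conclusion_of_local` — THE LOCAL END GLUE: `X` regular Noetherian integral, `S₁` a state with a summand and `K♭ ≠ ⊥`,
  `j : X₀ ⟶ X` an open immersion with `cosupp K♭ ⊆ j(X₀)`, `t₀` a multiple blow-up of `X₀` with regular centres over `j⁻¹ cosupp K♭`
  and `IsLocallyPrincipal ((K♭.comap j).comap t₀.comp)` ⟹ the `PhaseCOne` conclusion for `S₁`.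

AI-written; AI review is weaker than expert review.

## References
* U. Görtz, T. Wedhorn, *Algebraic Geometry I* (2nd ed. 2020), Prop. 13.91 (1)–(2). [GortzWedhorn2020]
* J. Kollár, *Lectures on Resolution of Singularities* (2007), (3.111) Step 3. [Kollar2007]
-/

-- `Summit.<Summit>.<Sub>.Theorems` with `Sub = Summit` (single-conjunct summit, D-0017)
set_option linter.dupNamespace false

noncomputable section

open CategoryTheory AlgebraicGeometry TopologicalSpace IsLocalRing
open Literature.AlgebraicGeometry.Resolution
open Scheme.IdealSheafData

namespace Summit.ResolutionOfSingularities.ResolutionOfSingularities.Theorems.DepthMultiHost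

universe u

namespace MultiHostState

/-- [OURS · L1 W5.2] **Integral tops and non-zero transforms**: over an integral scheme, a multiple blow-up whose centres lie over
the cosupport of a NON-ZERO ideal sheaf `K` has integral top, and `K𝒪_top ≠ 0` (each centre is a proper closed subset since the
generic point is off `cosupp K`). [cite: StacksProject, Tag 02OS] -/
theorem centreSeq_isIntegral_top_and_comap_ne_bot :
    ∀ {X : Scheme.{u}} (s : CentreSeq X) [IsIntegral X] {K : X.IdealSheafData}, K ≠ ⊥ →
      s.CentresOver (K.support : Set X) → IsIntegral s.top ∧ K.comap s.comp ≠ ⊥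
  | X, .nil _, _, K, hK, _ => by
    refine ⟨‹IsIntegral X›, ?_⟩
    change K.comap (𝟙 X) ≠ ⊥
    rwa [Scheme.IdealSheafData.comap_id]
  | X, .cons C rest, _, K, hK, hover => by
    obtain ⟨hC, hrest⟩ := hover
    have hCtop : C.support ≠ ⊤ := fun h =>
      not_mem_support_genericPoint hK (hC (by rw [h]; trivial))
    have hC0 : C ≠ ⊥ := fun h => hCtop (by rw [h, Scheme.IdealSheafData.support_bot])
    haveI : IsIntegral (blowup C) := (blowup.isBlowup C).isIntegral hC0
    have hK' : K.comap (blowup.π C) ≠ ⊥ := (blowup.isBlowup C).comap_ne_bot hCtop hK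
    have hrest' : rest.CentresOver ((K.comap (blowup.π C)).support : Set (blowup C)) := by
      rw [Scheme.IdealSheafData.support_comap]; exact hrest
    obtain ⟨hint, hne⟩ := centreSeq_isIntegral_top_and_comap_ne_bot rest hK' hrest'
    refine ⟨hint, ?_⟩
    change K.comap (rest.comp ≫ blowup.π C) ≠ ⊥
    rwa [Scheme.IdealSheafData.comap_comp]

/-- [OURS · L1 W5.2] **THE LOCAL END GLUE (RULING G11-51 (5)).** `X` regular Noetherian integral, `S₁` a state with a summand and
non-zero residual `K♭`; `j : X₀ ⟶ X` an open immersion with `cosupp K♭ ⊆ j(X₀)`; `t₀` a multiple blow-up of `X₀` with regular centres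
over `j⁻¹ cosupp K♭` making `(K♭|_{X₀})𝒪` locally principal (CE1's conclusion on the open).  Then the `PhaseCOne` conclusion holds for
`S₁`: extend `t₀` to `X` (`CentreSeqExtend.exists_centreSeq_of_open`), note that `K♭𝒪_top` is locally principal, non-zero on the integral
top, hence effective Cartier, and apply `phaseCOne_conclusion_of_isEffectiveCartier`.
[cite: GortzWedhorn2020, Prop. 13.91 (1)–(2)] [cite: Kollar2007, (3.111) Step 3] -/
theorem phaseCOne_conclusion_of_local {X X₀ : Scheme.{u}} [IsNoetherian X] [IsIntegral X] (hX : Scheme.IsRegular X)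
    (S₁ : MultiHostState X) (hn : S₁.n ≠ 0) (hK0 : S₁.residual.K ≠ ⊥)
    (j : X₀ ⟶ X) [IsOpenImmersion j] (hZj : (S₁.residual.K.support : Set X) ⊆ Set.range j.base)
    (t₀ : CentreSeq X₀) (h₀reg : t₀.AllRegular) (h₀over : t₀.CentresOver (j.base ⁻¹' (S₁.residual.K.support : Set X)))
    (h₀lp : IsLocallyPrincipal ((S₁.residual.K.comap j).comap t₀.comp)) :
    ∃ (s : CentreSeq X), s.AllRegular ∧ s.CentresOver (S₁.K.support : Set X) ∧ Scheme.IsRegular s.top ∧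
      ∃ (_ : IsNoetherian s.top) (M : s.top.IdealSheafData) (S₂ : MultiHostState s.top),
        S₁.K.comap s.comp = M * S₂.K ∧ IsEffectiveCartier M ∧ S₂.n ≠ 0 ∧
        ∃ (U : s.top.Opens), S₂.residual.IsEndOn U := by
  obtain ⟨t, htreg, htover, httop, hlp⟩ :=
    CentreSeqExtend.exists_centreSeq_of_open hX j S₁.residual.K.support.isClosed hZj t₀ h₀reg h₀over
  obtain ⟨hint, hne⟩ := centreSeq_isIntegral_top_and_comap_ne_bot t hK0 htover
  haveI := hint
  exact S₁.phaseCOne_conclusion_of_isEffectiveCartier hn t htreg htover httop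
    ((hlp S₁.residual.K le_rfl h₀lp).isEffectiveCartier_of_ne_bot hne)

end MultiHostState

end Summit.ResolutionOfSingularities.ResolutionOfSingularities.Theorems.DepthMultiHost

end
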